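import Summits.HodgeConjecture.HodgeConjecture.Theorems.F0P3RamClsOfRecord                 -- «RC»: `ramCls₀`, `ramCls₀_finite_of_isHolCotangentAt`
import Summits.HodgeConjecture.HodgeConjecture.Theorems.F0P3ClassTokensOfRecord            -- ★ p819048: `Cls`, `cl`, `rep`, `rep_cl_areUnitarilyEquivalent`
import HarnessLib

/-!
# Crux `H413` — rung 4, ED. 4, row «RC» (K4), RULING (V36)(g): `admUnitConstituents` and `ramCls₀` are invariant under unitary equivalence; transport along
# `rep ∘ cl` — the T5 kit reads `ramCls c` at `c = cl P` through the representative `rep (cl P) ≃ P` (Dixmier 1977 §13.1.3; Rogawski 1990 §14.5)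

Floor-0 programme P3 «U3-mult», seat B-p08 (g20); crux item stmt-HodgeConjecture-24833 (`HCCMUnconditional.H413`); F0P3-plan (g5) RULING (V36)(g) (pattern ★
`hasToken_rep_cl_iff`, ★ `cptTriv₀_cl_iff`).  PROOF lane (`--supports stmt-HodgeConjecture-24833 --as helper`): theorems only, no `def`, no named fact, no instance,
no notation, no `sorry`.  HONEST LABEL: HC_CM is proved only modulo the printed citations until rung 0 closes; this file discharges none of them.

* `admUnitConstituents_subset_of_areUnitarilyEquivalent` ∕ `admUnitConstituents_eq_of_areUnitarilyEquivalent` — a unitary equivalence `e : P ≃ P′` restricts to an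
  injective `U(H)(L⁺_v)`-map of the smooth parts (★ `Representation.IntertwiningMap`), so constituents of `P^∞|_v` are constituents of `P′^∞|_v` (★
  `IsConstituentOf.of_injective`); admissibility ∕ unitarizability are properties of the class.
* **`admUnitConstituents_rep_cl`**, **`ramCls₀_rep_cl`**, **`ramCls₀_rep_cl_finite_of_isHolCotangentAt`** (pin (x) of the T5 kit at `𝔠₀`, hol branch, in the
  kit's reading `ramCls (cl P) := ramCls₀ (rep (cl P))`).

References: [Dixmier1977] §13.1.3; [Rogawski1990] §14.5 p. 237; [BushnellHenniart2006] §2; [FlathCorvallis1979] Thm. 3.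
-/

set_option autoImplicit false
-- the mandated namespace repeats `HodgeConjecture.HodgeConjecture`, as in every `Theorems/*.lean` of this sub-problem
set_option linter.dupNamespace false

noncomputable section

open scoped InnerProductSpace Matrix ComplexOrder
open MeasureTheory NumberField IsDedekindDomain
open Literature.NumberTheory.Automorphic Literature.NumberTheory.Automorphic.UnitaryGroup
open Literature.NumberTheory.Automorphic.UnitaryGroup.CotangentForms
open ContRepresentation (AreUnitarilyEquivalent)
open Summit.HodgeConjecture.HodgeConjecture.Cruxes.H413.F0P3ClassTokenChoice
open Summit.HodgeConjecture.HodgeConjecture.Cruxes.H413.F0P3ClassTokensOfRecord (cl rep rep_cl_areUnitarilyEquivalent)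

namespace Summit.HodgeConjecture.HodgeConjecture.Cruxes.H413.F0P3RamClsOfRecord

variable {L : Type} [Field L] [NumberField L] [IsCMField L] {H : Matrix (Fin 3) (Fin 3) L}

section Transport

variable {μ : Measure (adelicGroupData (↥(maximalRealSubfield L)) L (IsCMField.complexConj L) 3 H).automorphicQuotient}
  [(adelicGroupData (↥(maximalRealSubfield L)) L (IsCMField.complexConj L) 3 H).IsAutomorphicMeasure μ]

/-- **Admissible unitarizable constituents at `v` transport along a unitary equivalence `P ≃ P′`**: the equivalence restricts to an injective `U(H)(L⁺_v)`-map of the smooth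
parts, so constituents of `P^∞|_v` are constituents of `P′^∞|_v` (★ `IsConstituentOf.of_injective`); admissibility ∕ unitarizability ∕ sphericity are properties of the class.
[cite: BushnellHenniart2006, §2] [cite: Dixmier1977, §13.1.3] -/
theorem admUnitConstituents_subset_of_areUnitarilyEquivalent
    {P P' : DiscreteAutomorphicRep (adelicGroupData (↥(maximalRealSubfield L)) L (IsCMField.complexConj L) 3 H) μ}
    (h : AreUnitarilyEquivalent P.space.toContRep P'.space.toContRep) (v : HeightOneSpectrum (𝓞 ↥(maximalRealSubfield L))) :
    admUnitConstituents P v ⊆ admUnitConstituents P' v := by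
  obtain ⟨e, -⟩ := h
  rintro c ⟨hc, ha, hu⟩
  refine ⟨?_, ha, hu⟩
  -- the intertwining identity on vectors and the restriction of `e` to the smooth parts
  have he : ∀ (b : finAdelic (↥(maximalRealSubfield L)) L (IsCMField.complexConj L) 3 H) (x : ↥P.space.toSubmodule),
      e.toContinuousLinearEquiv (P.finRep b x) = P'.finRep b (e.toContinuousLinearEquiv x) := fun b x =>
    DFunLike.congr_fun (e.isIntertwining (finAdelicToAdelic (↥(maximalRealSubfield L)) L (IsCMField.complexConj L) 3 H b)) x
  have hsm : ∀ x : ↥P.finRep.smoothPart.toSubmodule, P'.finRep.IsSmoothVector (e.toContinuousLinearEquiv (x : ↥P.space.toSubmodule)) := by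
    intro x
    refine P'.finRep.isSmoothVector_of_le x.2 fun g hg => ?_
    rw [Representation.mem_stabilizerSubgroup, ← he, (P.finRep.mem_stabilizerSubgroup _ g).1 hg]
  let f₀ : ↥P.finRep.smoothPart.toSubmodule →ₗ[ℂ] ↥P'.finRep.smoothPart.toSubmodule :=
    { toFun := fun x => ⟨e.toContinuousLinearEquiv (x : ↥P.space.toSubmodule), hsm x⟩
      map_add' := fun x y => Subtype.ext (by simp only [Submodule.coe_add, map_add])
      map_smul' := fun c x => Subtype.ext (by simp only [Submodule.coe_smul, map_smul, RingHom.id_apply]) }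
  let f : Representation.IntertwiningMap
      (P.finRep.smoothPart.toRepresentation.comp (inclPlace (↥(maximalRealSubfield L)) L (IsCMField.complexConj L) 3 H v))
      (P'.finRep.smoothPart.toRepresentation.comp (inclPlace (↥(maximalRealSubfield L)) L (IsCMField.complexConj L) 3 H v)) :=
    LinearMap.intertwiningMap_of_isIntertwiningMap
      (ρ := P.finRep.smoothPart.toRepresentation.comp (inclPlace (↥(maximalRealSubfield L)) L (IsCMField.complexConj L) 3 H v))
      (σ := P'.finRep.smoothPart.toRepresentation.comp (inclPlace (↥(maximalRealSubfield L)) L (IsCMField.complexConj L) 3 H v)) f₀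
      fun g x => Subtype.ext (he _ _)
  have hf : Function.Injective f := by
    intro a b hab
    have h' : f₀ a = f₀ b := hab
    have h'' : e.toContinuousLinearEquiv (a : ↥P.space.toSubmodule) = e.toContinuousLinearEquiv (b : ↥P.space.toSubmodule) :=
      congrArg Subtype.val h'
    exact Subtype.ext (e.toContinuousLinearEquiv.injective h'')
  exact hc.of_injective f hf

/-- **`admUnitConstituents` is invariant under unitary equivalence.** [cite: Dixmier1977, §13.1.3] [cite: BushnellHenniart2006, §2] -/
theorem admUnitConstituents_eq_of_areUnitarilyEquivalent
    {P P' : DiscreteAutomorphicRep (adelicGroupData (↥(maximalRealSubfield L)) L (IsCMField.complexConj L) 3 H) μ}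
    (h : AreUnitarilyEquivalent P.space.toContRep P'.space.toContRep) (v : HeightOneSpectrum (𝓞 ↥(maximalRealSubfield L))) :
    admUnitConstituents P v = admUnitConstituents P' v :=
  Set.Subset.antisymm (admUnitConstituents_subset_of_areUnitarilyEquivalent h v) (admUnitConstituents_subset_of_areUnitarilyEquivalent h.symm v)

/-- **(V36)(g) — `admUnitConstituents (rep (cl P)) v = admUnitConstituents P v`** (★ `rep_cl_areUnitarilyEquivalent`). [cite: Dixmier1977, §13.1.3] -/
theorem admUnitConstituents_rep_cl (P : DiscreteAutomorphicRep (adelicGroupData (↥(maximalRealSubfield L)) L (IsCMField.complexConj L) 3 H) μ)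
    (v : HeightOneSpectrum (𝓞 ↥(maximalRealSubfield L))) :
    admUnitConstituents (rep (adelicGroupData (↥(maximalRealSubfield L)) L (IsCMField.complexConj L) 3 H) μ
        (cl (adelicGroupData (↥(maximalRealSubfield L)) L (IsCMField.complexConj L) 3 H) μ P)) v =
      admUnitConstituents P v :=
  admUnitConstituents_eq_of_areUnitarilyEquivalent
    (rep_cl_areUnitarilyEquivalent (adelicGroupData (↥(maximalRealSubfield L)) L (IsCMField.complexConj L) 3 H) μ P) v

/-- **`ramCls₀ (rep (cl P)) = ramCls₀ P`.** [cite: Dixmier1977, §13.1.3] [cite: Rogawski1990, §14.5 p. 237] -/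
theorem ramCls₀_rep_cl (P : DiscreteAutomorphicRep (adelicGroupData (↥(maximalRealSubfield L)) L (IsCMField.complexConj L) 3 H) μ) :
    ramCls₀ (rep (adelicGroupData (↥(maximalRealSubfield L)) L (IsCMField.complexConj L) 3 H) μ
        (cl (adelicGroupData (↥(maximalRealSubfield L)) L (IsCMField.complexConj L) 3 H) μ P)) = ramCls₀ P := by
  ext v
  rw [mem_ramCls₀_iff, mem_ramCls₀_iff, admUnitConstituents_rep_cl]

/-- **PIN (x) OF THE T5 KIT AT `𝔠₀`, holomorphic branch: `(ramCls₀ (rep (cl P))).Finite` for a holomorphic-cotangent `P`.** [cite: FlathCorvallis1979, Thm. 3]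
[cite: Rogawski1990, §14.5 p. 237] -/
theorem ramCls₀_rep_cl_finite_of_isHolCotangentAt (ι : L →+* ℂ) (T : GL (Fin 3) ℂ)
    (hT : (T : Matrix (Fin 3) (Fin 3) ℂ)ᴴ * H.map ι * (T : Matrix (Fin 3) (Fin 3) ℂ) = Literature.Geometry.ComplexHyperbolic.BallModel.J)
    (hdef : ∀ τ' : L →+* ℂ, InfinitePlace.mk τ' ≠ InfinitePlace.mk ι → (H.map τ').PosDef) (h2 : 2 ≤ Module.finrank ℚ ↥(maximalRealSubfield L))
    (P : DiscreteAutomorphicRep (adelicGroupData (↥(maximalRealSubfield L)) L (IsCMField.complexConj L) 3 H) μ)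
    (hP : P.IsHolCotangentAt (cmArchSection L ι H T hT) (cmCompactFactor L ι H T hT)) :
    (ramCls₀ (rep (adelicGroupData (↥(maximalRealSubfield L)) L (IsCMField.complexConj L) 3 H) μ
        (cl (adelicGroupData (↥(maximalRealSubfield L)) L (IsCMField.complexConj L) 3 H) μ P))).Finite := by
  rw [ramCls₀_rep_cl]
  exact ramCls₀_finite_of_isHolCotangentAt ι T hT hdef h2 P hP

end Transport

end Summit.HodgeConjecture.HodgeConjecture.Cruxes.H413.F0P3RamClsOfRecord

end
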